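import Summits.Ventures.AbcSig.Rows.TemplateC

/-!
# Venture AbcSig — ROW TEMPLATES with EXPONENT-SPECIFIC (Kraus-refined) allowed traces: `xⁿ + yⁿ = C z²`, fixed `n`

HONEST FRAMING. Fully PROVED template theorems of a COMPUTATION cell (`pub-abcsig`); CONDITIONAL on named
hypotheses, no claim on ABC or any summit. For a FIXED prime exponent `n`, the sieve may use, at auxiliary primes
`ℓ ≡ 1 (mod n)`, the exact image of the Frey family's traces when `xⁿ, yⁿ` range over `n`-th powers modulo `ℓ`
(Kraus's refinement of [BS04, Lemma 4.2]; the cell's module for single-exponent COMPUTATION rows, e.g. its rows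
`C7-n11 … C7-n19` for `xⁿ + yⁿ = 7z²`). In Lean the refined trace table `A : ℕ → List ℤ` is DATA (a generated `def`,
transcribed from the engines' point counts) and its correctness is the NAMED hypothesis
`NewformModel.RefinedTraces M fam A` ("for data in the family `fam`, a newform from which `ρ^E_n` arises satisfies
the congruences `c_ℓ ≡ t (mod ν)` with `t ∈ A ℓ`") — CITED ([BS04] Frey curves (p. 27), (3.1), Lemma 4.2's proof) +
COMPUTED (the table; referee-cross-checked `refallowed.py`), never proved here. Given that, `row_template_refined_even`
(level `2C²`) and `row_template_refined_odd` (level `32C²`) have exactly the shape of `Rows/TemplateC.lean` with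
certificates checked against `A` instead of `bs04Allowed`.

Reference: [BS04] Bennett–Skinner, Canad. J. Math. 56 (2004); A. Kraus, Canad. J. Math. 49 (1997) (the auxiliary-prime
method); cell files `engine/engine-2/results/C7/allowed_C7_*_n*.json`.
-/

namespace Summit.Ventures.AbcSig

/-- **NAMED HYPOTHESIS (refined traces).** For every datum `S` in the family `fam` and every newform `f` (any level)
from which `ρ^E_{S.n}` arises, the trace congruences hold with traces in the table `A`:
`M.ArisesMod f S.n A`. With `A = bs04Allowed` this is the second half of `BS04Package`; with an exponent-specific
table it is Kraus's refinement (cited + computed). -/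
def NewformModel.RefinedTraces (M : NewformModel) (fam : FreyDatum → Prop) (A : ℕ → List ℤ) : Prop :=
  ∀ (S : FreyDatum) (N : ℕ) (f : M.Form N), fam S → M.Arises S N f → M.ArisesMod f S.n A

/-- **Refined row template, `xy` even** (level `2C²`, family "`(1,1,C)`, exponent `n`, `xy` even", table `A`). -/
theorem row_template_refined_even (C : ℕ) (hsq : Squarefree C) (hCodd : Odd C) (M : NewformModel)
    (hP : M.BS04Package) {orbsE : List OrbitData} (hDE : M.DataComplete (2 * C ^ 2) orbsE)
    (n : ℕ) (hn : n.Prime) (h7 : 7 ≤ n) (hnC : ¬ n ∣ C) (A : ℕ → List ℤ)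
    (hA : M.RefinedTraces (fun S => S.A = 1 ∧ S.B = 1 ∧ S.C = C ∧ S.n = n ∧ 2 ∣ S.a * S.b) A)
    (hE : ∀ o ∈ orbsE, (∀ e ∈ o.coeffs, e.ell.Prime ∧ e.ell ≠ 2 ∧ ¬ e.ell ∣ 2 * C ^ 2) ∧
      (o.Eliminated A n ∨ M.Excludes (2 * C ^ 2) o
        (fun S => S.A = 1 ∧ S.B = 1 ∧ S.C = C ∧ S.n = n ∧ 2 ∣ S.a * S.b)))
    (a b c : ℤ) (heven : 2 ∣ a * b) : ¬ IsPrimitiveSolution 1 1 C n a b c := by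
  intro hsol
  have hCpos : 0 < C := hCodd.pos
  have hCoddZ : ¬ 2 ∣ (C : ℤ) := by
    intro h
    have h' : (2 : ℕ) ∣ C := by exact_mod_cast h
    exact (Nat.not_even_iff_odd.mpr hCodd) (even_iff_two_dvd.mpr h')
  obtain ⟨a', b', hsol', hb', hab'⟩ :
      ∃ a' b' : ℤ, IsPrimitiveSolution 1 1 C n a' b' c ∧ 2 ∣ b' ∧ a' * b' = a * b := by
    rcases Int.prime_two.dvd_mul.mp heven with h2 | h2
    · exact ⟨b, a, hsol.swap, h2, mul_comm _ _⟩
    · exact ⟨a, b, hsol, h2, rfl⟩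
  have hc2 : ¬ 2 ∣ c := by
    intro h2c
    obtain ⟨-, -, -, -, -, -, hbc⟩ := hsol'
    have hu := hbc.isUnit_of_dvd' (by simpa using hb') (Dvd.dvd.mul_left h2c _)
    rcases Int.isUnit_iff.mp hu with h | h <;> omega
  obtain ⟨c', hc'sgn, hc'⟩ := exists_sign_sub_four_dvd c C hc2 hCoddZ
  have hsol'' : IsPrimitiveSolution 1 1 C n a' b' c' := hsol'.of_sign hc'sgn
  have hcase : FreyCase.Holds .v₇ 1 1 C n a' b' c' := by
    refine ⟨?_, hc'⟩
    have h2n : (2 : ℤ) ^ 7 ∣ b' ^ n := (pow_dvd_pow 2 h7).trans (pow_dvd_pow_of_dvd hb' n)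
    simpa using h2n
  have hndvd : ¬ n ∣ 1 * 1 * C := by simpa using hnC
  have hfree : ∀ q : ℕ, q.Prime → ¬ q ^ n ∣ 1 ∧ ¬ q ^ n ∣ 1 := by
    intro q hq
    have : ¬ q ^ n ∣ 1 := by
      intro h
      have h1 := Nat.dvd_one.mp h
      rw [Nat.pow_eq_one] at h1
      rcases h1 with h1 | h1
      · exact hq.one_lt.ne' h1
      · omega
    exact ⟨this, this⟩
  have hab1 : a' * b' ≠ 1 := by
    intro h; rw [h] at hab'; omega
  have hab2 : a' * b' ≠ -1 := by
    intro h; rw [h] at hab'; omega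
  obtain ⟨hlev, -⟩ := hP ⟨1, 1, C, n, a', b', c'⟩ .v₇ one_pos one_pos hCpos hsq hn h7 hndvd hfree
    hsol'' hab1 hab2 hcase
  obtain ⟨f, hf⟩ := hlev (2 * C ^ 2) (bs04Level_one_one C n hsq hCodd hnC).1
  have heven' : 2 ∣ a' * b' := by rw [hab']; exact heven
  have hmod := hA ⟨1, 1, C, n, a', b', c'⟩ (2 * C ^ 2) f ⟨rfl, rfl, rfl, rfl, heven'⟩ hf
  exact M.no_newform_arises orbsE hDE (fun S => S.A = 1 ∧ S.B = 1 ∧ S.C = C ∧ S.n = n ∧ 2 ∣ S.a * S.b)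
    ⟨1, 1, C, n, a', b', c'⟩ ⟨rfl, rfl, rfl, rfl, heven'⟩ A hE f hf hmod

/-- **Refined row template, `xy` odd** (level `32C²`, family "`(1,1,C)`, exponent `n`, `xy` odd", table `A`). -/
theorem row_template_refined_odd (C : ℕ) (hC3 : 3 ≤ C) (hsq : Squarefree C) (hCodd : Odd C) (M : NewformModel)
    (hP : M.BS04Package) {orbsO : List OrbitData} (hDO : M.DataComplete (32 * C ^ 2) orbsO)
    (n : ℕ) (hn : n.Prime) (h7 : 7 ≤ n) (hnC : ¬ n ∣ C) (A : ℕ → List ℤ)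
    (hA : M.RefinedTraces (fun S => S.A = 1 ∧ S.B = 1 ∧ S.C = C ∧ S.n = n ∧ ¬ 2 ∣ S.a * S.b) A)
    (hO : ∀ o ∈ orbsO, (∀ e ∈ o.coeffs, e.ell.Prime ∧ e.ell ≠ 2 ∧ ¬ e.ell ∣ 32 * C ^ 2) ∧
      (o.Eliminated A n ∨ M.Excludes (32 * C ^ 2) o
        (fun S => S.A = 1 ∧ S.B = 1 ∧ S.C = C ∧ S.n = n ∧ ¬ 2 ∣ S.a * S.b)))
    (a b c : ℤ) (hodd : ¬ 2 ∣ a * b) : ¬ IsPrimitiveSolution 1 1 C n a b c := by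
  intro hsol
  have hCpos : 0 < C := hCodd.pos
  have hnodd : Odd n := hn.odd_of_ne_two (by omega)
  have hCoddZ : ¬ 2 ∣ (C : ℤ) := by
    intro h
    have h' : (2 : ℕ) ∣ C := by exact_mod_cast h
    exact (Nat.not_even_iff_odd.mpr hCodd) (even_iff_two_dvd.mpr h')
  have heq : a ^ n + b ^ n = C * c ^ 2 := by simpa using hsol.1
  have hCc : (C : ℤ) * c ≠ 0 := by simpa using hsol.2.2.2.1
  by_cases htriv : a * b = 1 ∨ a * b = -1
  · exact no_trivial_solution C hC3 n hnodd a b c htriv hCc heq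
  have hab1 : a * b ≠ 1 := fun h => htriv (Or.inl h)
  have hab2 : a * b ≠ -1 := fun h => htriv (Or.inr h)
  have hodd5 : ¬ 2 ∣ a * b * (1 : ℕ) * (1 : ℕ) * (C : ℕ) := by
    intro h
    have h' : (2 : ℤ) ∣ a * b * C := by simpa using h
    rcases Int.prime_two.dvd_mul.mp h' with h2 | h2
    · exact hodd h2
    · exact hCoddZ h2
  have hndvd : ¬ n ∣ 1 * 1 * C := by simpa using hnC
  have hfree : ∀ q : ℕ, q.Prime → ¬ q ^ n ∣ 1 ∧ ¬ q ^ n ∣ 1 := by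
    intro q hq
    have : ¬ q ^ n ∣ 1 := by
      intro h
      have h1 := Nat.dvd_one.mp h
      rw [Nat.pow_eq_one] at h1
      rcases h1 with h1 | h1
      · exact hq.one_lt.ne' h1
      · omega
    exact ⟨this, this⟩
  have hL := (bs04Level_one_one C n hsq hCodd hnC).2
  let fam : FreyDatum → Prop := fun S => S.A = 1 ∧ S.B = 1 ∧ S.C = C ∧ S.n = n ∧ ¬ 2 ∣ S.a * S.b
  rcases case_i_or_swap hsol hnodd hodd5 with hcase | hcase
  · obtain ⟨hlev, -⟩ := hP ⟨1, 1, C, n, a, b, c⟩ .i one_pos one_pos hCpos hsq hn h7 hndvd hfree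
      hsol hab1 hab2 hcase
    obtain ⟨f, hf⟩ := hlev (32 * C ^ 2) hL
    have hmod := hA ⟨1, 1, C, n, a, b, c⟩ (32 * C ^ 2) f ⟨rfl, rfl, rfl, rfl, hodd⟩ hf
    exact M.no_newform_arises orbsO hDO fam ⟨1, 1, C, n, a, b, c⟩ ⟨rfl, rfl, rfl, rfl, hodd⟩ A hO f hf hmod
  · have hodd' : ¬ 2 ∣ b * a := by rw [mul_comm]; exact hodd
    have hba1 : b * a ≠ 1 := by rw [mul_comm]; exact hab1
    have hba2 : b * a ≠ -1 := by rw [mul_comm]; exact hab2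
    obtain ⟨hlev, -⟩ := hP ⟨1, 1, C, n, b, a, c⟩ .i one_pos one_pos hCpos hsq hn h7 hndvd hfree
      hsol.swap hba1 hba2 hcase
    obtain ⟨f, hf⟩ := hlev (32 * C ^ 2) hL
    have hmod := hA ⟨1, 1, C, n, b, a, c⟩ (32 * C ^ 2) f ⟨rfl, rfl, rfl, rfl, hodd'⟩ hf
    exact M.no_newform_arises orbsO hDO fam ⟨1, 1, C, n, b, a, c⟩ ⟨rfl, rfl, rfl, rfl, hodd'⟩ A hO f hf hmod

end Summit.Ventures.AbcSig
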